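import Mathlib.Analysis.Distribution.AEEqOfIntegralContDiff
import Mathlib.MeasureTheory.Function.LocallyIntegrable
import Literature.Analysis.FluidPDE.AxisymmetricEuler
import Summits.NavierStokesRegularity.NavierStokesRegularity.Theorems.L3TimeExponentPincerEquivariantLimit
import Summits.NavierStokesRegularity.NavierStokesRegularity.Theorems.L3TimeExponentPincerTimeCutConvergence
import HarnessLib.Audit
import HarnessLib

/-!
# L3TimeExponentPincer — space–time form: absence of swirl passes to `L³_loc` limits

Support kernel for the crux `L3CascadeJaw` (item stmt-NavierStokesRegularity-19499) of route
`L3TimeExponentPincer`; the space–time twin of `…Theorems.L3TimeExponentPincerSwirlFreeLimit`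
for CASE B of the compactness step (J) of planner nsreg-p2's ROUND-12 §2b (blueprint attached to
the item).  The swirl about the vertical axis through `a` of a space–time field
`U : ℝ × ℝ³ → ℝ³` is `Γ_a U (t,x) = (x - a)₀ U₁(t,x) - (x - a)₁ U₀(t,x)`; it is linear in `U` with
coefficients smooth in `(t,x)` and continuous in `a`, so:

* `tendsto_integral_mul_spaceTime_swirlAbout` — if `∫ g • U_k → ∫ g • U` for all
  `g ∈ C_c^∞(ℝ × ℝ³; ℝ)`, all fields locally integrable, and `a_k → a`, then
  `∫ g Γ_{a_k} U_k → ∫ g Γ_a U`;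
* `ae_spaceTime_swirlAbout_eq_zero_of_tendsto` — if moreover `Γ_{a_k} U_k = 0`, then `Γ_a U = 0` a.e.;
* **`ae_swirlAbout_eq_zero_of_L3loc`** — the form used by (J): `∫∫_K ‖u^k - u‖³ → 0` on compacts
  `K ⊆ {t > 0}` (the `tendsto_lintegral` clause of `RusinSverak2011.CompactnessSituation`), local
  integrability on `{t > 0}`, slices `u^k(t,·)` (`t > 0`) swirl-free about the vertical axis through
  `a_k`, `a_k → a` ⇒ `Γ_a u(t,·)(x) = 0` for a.e. `(t,x)` with `t > 0` (time cuts
  `…TimeCutConvergence` and a countable union).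

WHAT THIS IS NOT: not NS regularity or blow-up; linear bookkeeping; the crux `L3CascadeJaw` is
untouched; no crux claim.
-/

noncomputable section

open MeasureTheory Set Function Filter Topology Metric
open scoped ENNReal NNReal ContDiff

namespace Summit.NavierStokesRegularity.NavierStokesRegularity.Theorems.L3TimeExponentPincerSpaceTimeSwirlFree

open Literature.Analysis.FluidPDE
open Summit.NavierStokesRegularity.NavierStokesRegularity.Theorems.L3TimeExponentPincerEquivariantLimit
open Summit.NavierStokesRegularity.NavierStokesRegularity.Theorems.L3TimeExponentPincerTimeCutConvergence

/-- Components of the vector integrals `∫ g • U` over `ℝ × ℝ³` are the scalar integrals `∫ g U_i`. -/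
theorem integral_smul_apply_eq {g : ℝ × EuclideanSpace ℝ (Fin 3) → ℝ}
    {U : ℝ × EuclideanSpace ℝ (Fin 3) → EuclideanSpace ℝ (Fin 3)}
    (hint : Integrable (fun z => g z • U z)) (i : Fin 3) :
    (∫ z, g z • U z) i = ∫ z, g z * U z i := by
  have h := (ContinuousLinearMap.integral_comp_comm (EuclideanSpace.proj i) hint).symm
  simp only [PiLp.proj_apply] at h
  simpa [smul_eq_mul] using h

/-- **Space–time swirl integrals pass to the limit along converging axes.** -/
theorem tendsto_integral_mul_spaceTime_swirlAbout
    {U : ℕ → ℝ × EuclideanSpace ℝ (Fin 3) → EuclideanSpace ℝ (Fin 3)}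
    {Ul : ℝ × EuclideanSpace ℝ (Fin 3) → EuclideanSpace ℝ (Fin 3)} {a : ℕ → EuclideanSpace ℝ (Fin 3)}
    {al : EuclideanSpace ℝ (Fin 3)} (ha : Tendsto a atTop (𝓝 al))
    (hU : ∀ k, LocallyIntegrable (U k) volume) (hUl : LocallyIntegrable Ul volume)
    (hconv : ∀ g : ℝ × EuclideanSpace ℝ (Fin 3) → ℝ, ContDiff ℝ ∞ g → HasCompactSupport g →
      Tendsto (fun k => ∫ z, g z • U k z) atTop (𝓝 (∫ z, g z • Ul z)))
    {g : ℝ × EuclideanSpace ℝ (Fin 3) → ℝ} (hg : ContDiff ℝ ∞ g) (hgs : HasCompactSupport g) :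
    Tendsto (fun k => ∫ z, g z * ((z.2 - a k) 0 * U k z 1 - (z.2 - a k) 1 * U k z 0)) atTop
      (𝓝 (∫ z, g z * ((z.2 - al) 0 * Ul z 1 - (z.2 - al) 1 * Ul z 0))) := by
  -- coordinate test functions
  have hcoord : ∀ j : Fin 3, ContDiff ℝ ∞ (fun z : ℝ × EuclideanSpace ℝ (Fin 3) => z.2 j) := fun j =>
    (EuclideanSpace.proj (𝕜 := ℝ) (ι := Fin 3) j).contDiff.comp contDiff_snd
  have hgj : ∀ j : Fin 3, ContDiff ℝ ∞ (fun z : ℝ × EuclideanSpace ℝ (Fin 3) => g z * (z.2 - al) j) :=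
    fun j => by
    simpa only [PiLp.sub_apply] using hg.mul ((hcoord j).sub (contDiff_const (c := al j)))
  have hgjs : ∀ j : Fin 3, HasCompactSupport (fun z : ℝ × EuclideanSpace ℝ (Fin 3) => g z * (z.2 - al) j) :=
    fun j => hgs.mul_right
  -- integrability of the scalar products
  have hIc : ∀ (W : ℝ × EuclideanSpace ℝ (Fin 3) → EuclideanSpace ℝ (Fin 3)),
      LocallyIntegrable W volume → ∀ (h : ℝ × EuclideanSpace ℝ (Fin 3) → ℝ), ContDiff ℝ ∞ h →
      HasCompactSupport h → ∀ i : Fin 3, Integrable (fun z => h z * W z i) := by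
    intro W hW h hh hhs i
    have h1 := (locallyIntegrable_clm_comp hW (EuclideanSpace.proj (𝕜 := ℝ) (ι := Fin 3) i)
      ).integrable_smul_left_of_hasCompactSupport hh.continuous hhs
    simpa [smul_eq_mul] using h1
  have hI : ∀ (W : ℝ × EuclideanSpace ℝ (Fin 3) → EuclideanSpace ℝ (Fin 3)),
      LocallyIntegrable W volume → ∀ (h : ℝ × EuclideanSpace ℝ (Fin 3) → ℝ), ContDiff ℝ ∞ h →
      HasCompactSupport h → Integrable (fun z => h z • W z) := fun W hW h hh hhs =>
    hW.integrable_smul_left_of_hasCompactSupport hh.continuous hhs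
  -- pointwise algebra
  have hsplit : ∀ (W : ℝ × EuclideanSpace ℝ (Fin 3) → EuclideanSpace ℝ (Fin 3))
      (b : EuclideanSpace ℝ (Fin 3)) (z : ℝ × EuclideanSpace ℝ (Fin 3)),
      g z * ((z.2 - b) 0 * W z 1 - (z.2 - b) 1 * W z 0)
        = (g z * (z.2 - al) 0) * W z 1 - (g z * (z.2 - al) 1) * W z 0
          + ((al - b) 0 * (g z * W z 1) - (al - b) 1 * (g z * W z 0)) := by
    intro W b z
    simp only [PiLp.sub_apply]
    ring
  -- the scalar sequences converge
  have hT : ∀ (h : ℝ × EuclideanSpace ℝ (Fin 3) → ℝ), ContDiff ℝ ∞ h → HasCompactSupport h →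
      ∀ i : Fin 3, Tendsto (fun k => ∫ z, h z * U k z i) atTop (𝓝 (∫ z, h z * Ul z i)) := by
    intro h hh hhs i
    have h1 := ((EuclideanSpace.proj i).continuous.tendsto _).comp (hconv h hh hhs)
    have e1 : ∀ k, (EuclideanSpace.proj i) (∫ z, h z • U k z) = ∫ z, h z * U k z i := fun k => by
      rw [← integral_smul_apply_eq (hI _ (hU k) h hh hhs) i]; rfl
    have e2 : (EuclideanSpace.proj i) (∫ z, h z • Ul z) = ∫ z, h z * Ul z i := by
      rw [← integral_smul_apply_eq (hI _ hUl h hh hhs) i]; rfl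
    simpa only [Function.comp_def, e1, e2] using h1
  have hab : Tendsto (fun k => al - a k) atTop (𝓝 0) := by
    simpa using (tendsto_const_nhds (x := al)).sub ha
  have hab_j : ∀ j : Fin 3, Tendsto (fun k => (al - a k) j) atTop (𝓝 0) := fun j => by
    have h1 := (((EuclideanSpace.proj (𝕜 := ℝ) (ι := Fin 3) j).continuous.tendsto 0).comp hab)
    simpa [Function.comp_def] using h1
  have hint_k : ∀ k (j i : Fin 3), Integrable (fun z => (g z * (z.2 - al) j) * U k z i) :=
    fun k j i => hIc (U k) (hU k) _ (hgj j) (hgjs j) i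
  have hint_l : ∀ (j i : Fin 3), Integrable (fun z => (g z * (z.2 - al) j) * Ul z i) :=
    fun j i => hIc Ul hUl _ (hgj j) (hgjs j) i
  have hintg_k : ∀ k (i : Fin 3), Integrable (fun z => g z * U k z i) :=
    fun k i => hIc (U k) (hU k) g hg hgs i
  have hintg_l : ∀ (i : Fin 3), Integrable (fun z => g z * Ul z i) :=
    fun i => hIc Ul hUl g hg hgs i
  have ek : ∀ k, ∫ z, g z * ((z.2 - a k) 0 * U k z 1 - (z.2 - a k) 1 * U k z 0)
      = (∫ z, (g z * (z.2 - al) 0) * U k z 1) - (∫ z, (g z * (z.2 - al) 1) * U k z 0)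
        + ((al - a k) 0 * (∫ z, g z * U k z 1) - (al - a k) 1 * (∫ z, g z * U k z 0)) := by
    intro k
    have hAB : Integrable (fun z => (g z * (z.2 - al) 0) * U k z 1 - (g z * (z.2 - al) 1) * U k z 0) :=
      (hint_k k 0 1).sub (hint_k k 1 0)
    have hC : Integrable (fun z => (al - a k) 0 * (g z * U k z 1)) := (hintg_k k 1).const_mul _
    have hD : Integrable (fun z => (al - a k) 1 * (g z * U k z 0)) := (hintg_k k 0).const_mul _
    have hCD : Integrable (fun z => (al - a k) 0 * (g z * U k z 1) - (al - a k) 1 * (g z * U k z 0)) :=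
      hC.sub hD
    simp_rw [hsplit (U k) (a k)]
    rw [integral_add hAB hCD, integral_sub (hint_k k 0 1) (hint_k k 1 0), integral_sub hC hD,
      integral_const_mul, integral_const_mul]
  have el : ∫ z, g z * ((z.2 - al) 0 * Ul z 1 - (z.2 - al) 1 * Ul z 0)
      = (∫ z, (g z * (z.2 - al) 0) * Ul z 1) - (∫ z, (g z * (z.2 - al) 1) * Ul z 0)
        + ((al - al) 0 * (∫ z, g z * Ul z 1) - (al - al) 1 * (∫ z, g z * Ul z 0)) := by
    have hAB : Integrable (fun z => (g z * (z.2 - al) 0) * Ul z 1 - (g z * (z.2 - al) 1) * Ul z 0) :=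
      (hint_l 0 1).sub (hint_l 1 0)
    have hC : Integrable (fun z => (al - al) 0 * (g z * Ul z 1)) := (hintg_l 1).const_mul _
    have hD : Integrable (fun z => (al - al) 1 * (g z * Ul z 0)) := (hintg_l 0).const_mul _
    have hCD : Integrable (fun z => (al - al) 0 * (g z * Ul z 1) - (al - al) 1 * (g z * Ul z 0)) :=
      hC.sub hD
    simp_rw [hsplit Ul al]
    rw [integral_add hAB hCD, integral_sub (hint_l 0 1) (hint_l 1 0), integral_sub hC hD,
      integral_const_mul, integral_const_mul]
  rw [el]
  simp only [sub_self, PiLp.zero_apply, zero_mul]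
  refine Tendsto.congr (fun k => (ek k).symm) ?_
  have h1 := ((hT _ (hgj 0) (hgjs 0) 1).sub (hT _ (hgj 1) (hgjs 1) 0)).add
    (((hab_j 0).mul (hT g hg hgs 1)).sub ((hab_j 1).mul (hT g hg hgs 0)))
  simpa using h1

/-- **Absence of swirl passes to distributional limits, space–time form.** -/
theorem ae_spaceTime_swirlAbout_eq_zero_of_tendsto
    {U : ℕ → ℝ × EuclideanSpace ℝ (Fin 3) → EuclideanSpace ℝ (Fin 3)}
    {Ul : ℝ × EuclideanSpace ℝ (Fin 3) → EuclideanSpace ℝ (Fin 3)} {a : ℕ → EuclideanSpace ℝ (Fin 3)}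
    {al : EuclideanSpace ℝ (Fin 3)}
    (hsw : ∀ k z, (z.2 - a k) 0 * U k z 1 - (z.2 - a k) 1 * U k z 0 = 0)
    (ha : Tendsto a atTop (𝓝 al))
    (hU : ∀ k, LocallyIntegrable (U k) volume) (hUl : LocallyIntegrable Ul volume)
    (hconv : ∀ g : ℝ × EuclideanSpace ℝ (Fin 3) → ℝ, ContDiff ℝ ∞ g → HasCompactSupport g →
      Tendsto (fun k => ∫ z, g z • U k z) atTop (𝓝 (∫ z, g z • Ul z))) :
    ∀ᵐ z : ℝ × EuclideanSpace ℝ (Fin 3) ∂volume, (z.2 - al) 0 * Ul z 1 - (z.2 - al) 1 * Ul z 0 = 0 := by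
  have hcomp : ∀ i : Fin 3, LocallyIntegrable (fun z => Ul z i) volume := fun i =>
    locallyIntegrable_clm_comp hUl (EuclideanSpace.proj i)
  have hcoordc : ∀ j : Fin 3, Continuous (fun z : ℝ × EuclideanSpace ℝ (Fin 3) => (z.2 - al) j) :=
    fun j => by fun_prop
  have hLI : LocallyIntegrable (fun z : ℝ × EuclideanSpace ℝ (Fin 3) =>
      (z.2 - al) 0 * Ul z 1 - (z.2 - al) 1 * Ul z 0) volume := by
    rw [MeasureTheory.locallyIntegrable_iff]
    intro K hK
    exact (((hcomp 1).integrableOn_isCompact hK).continuousOn_mul (hcoordc 0).continuousOn hK).sub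
      (((hcomp 0).integrableOn_isCompact hK).continuousOn_mul (hcoordc 1).continuousOn hK)
  refine ae_eq_zero_of_integral_contDiff_smul_eq_zero hLI fun g hg hgs => ?_
  have hlim := tendsto_integral_mul_spaceTime_swirlAbout ha hU hUl hconv hg hgs
  have hzero : (fun k => ∫ z, g z * ((z.2 - a k) 0 * U k z 1 - (z.2 - a k) 1 * U k z 0)) = fun _ => 0 := by
    funext k
    have h1 : (fun z => g z * ((z.2 - a k) 0 * U k z 1 - (z.2 - a k) 1 * U k z 0))
        = fun _ => 0 := by
      funext z
      rw [hsw k z, mul_zero]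
    rw [h1, integral_zero]
  rw [hzero] at hlim
  have h0 : ∫ z, g z * ((z.2 - al) 0 * Ul z 1 - (z.2 - al) 1 * Ul z 0) = 0 :=
    tendsto_nhds_unique hlim tendsto_const_nhds
  simpa only [smul_eq_mul] using h0

/-! ### The form used by (J) -/

/-- **A.e. absence of swirl of `L³_loc` limits of swirl-free fields about converging axes.**
If `∫∫_K ‖u^k - u‖³ → 0` for every compact `K ⊆ {t > 0}`, all fields are locally integrable on
`{t > 0}`, each slice `u^k(t,·)` (`t > 0`) is swirl-free about the vertical axis through `a_k`
(`(x - a_k)₀ u^k₁ - (x - a_k)₁ u^k₀ = 0`), and `a_k → a`, then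
`(x - a)₀ u₁(t,x) - (x - a)₁ u₀(t,x) = 0` for a.e. `(t,x)` with `t > 0`. -/
theorem ae_swirlAbout_eq_zero_of_L3loc
    {useq : ℕ → ℝ → EuclideanSpace ℝ (Fin 3) → EuclideanSpace ℝ (Fin 3)}
    {u : ℝ → EuclideanSpace ℝ (Fin 3) → EuclideanSpace ℝ (Fin 3)}
    {a : ℕ → EuclideanSpace ℝ (Fin 3)} {al : EuclideanSpace ℝ (Fin 3)}
    (hL3 : ∀ K ⊆ {z : ℝ × EuclideanSpace ℝ (Fin 3) | 0 < z.1}, IsCompact K →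
      Tendsto (fun k => ∫⁻ z in K, ‖useq k z.1 z.2 - u z.1 z.2‖ₑ ^ (3 : ℕ)) atTop (𝓝 0))
    (huk : ∀ k, LocallyIntegrableOn (uncurry (useq k)) {z | 0 < z.1} volume)
    (hu : LocallyIntegrableOn (uncurry u) {z | 0 < z.1} volume)
    (hsw : ∀ k t, 0 < t → ∀ x : EuclideanSpace ℝ (Fin 3),
      (x - a k) 0 * useq k t x 1 - (x - a k) 1 * useq k t x 0 = 0)
    (ha : Tendsto a atTop (𝓝 al)) :
    ∀ᵐ z : ℝ × EuclideanSpace ℝ (Fin 3) ∂volume, 0 < z.1 →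
      (z.2 - al) 0 * u z.1 z.2 1 - (z.2 - al) 1 * u z.1 z.2 0 = 0 := by
  have hcut : ∀ n : ℕ, ∀ᵐ z : ℝ × EuclideanSpace ℝ (Fin 3) ∂volume, (1 : ℝ) / (n + 1) < z.1 →
      (z.2 - al) 0 * u z.1 z.2 1 - (z.2 - al) 1 * u z.1 z.2 0 = 0 := by
    intro n
    set δ : ℝ := 1 / (n + 1) with hδdef
    have hδ : 0 < δ := by positivity
    set S : Set (ℝ × EuclideanSpace ℝ (Fin 3)) := Ioi δ ×ˢ univ with hS
    have hL3' : ∀ K ⊆ {z : ℝ × EuclideanSpace ℝ (Fin 3) | 0 < z.1}, IsCompact K →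
        Tendsto (fun k => ∫⁻ z in K, ‖uncurry (useq k) z - uncurry u z‖ₑ ^ (3 : ℕ)) atTop (𝓝 0) :=
      hL3
    have h := ae_spaceTime_swirlAbout_eq_zero_of_tendsto
      (U := fun k => S.indicator (uncurry (useq k))) (Ul := S.indicator (uncurry u)) (a := a) (al := al)
      (fun k z => by
        by_cases hz : z ∈ S
        · rw [indicator_of_mem hz]
          exact hsw k z.1 (lt_trans hδ hz.1) z.2
        · simp [indicator_of_notMem hz])
      ha (fun k => locallyIntegrable_timeCut (huk k) hδ) (locallyIntegrable_timeCut hu hδ)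
      (fun g hg hgs => tendsto_integral_smul_timeCut hL3' huk hu hδ hg.continuous hgs)
    filter_upwards [h] with z hz hzt
    have hzS : z ∈ S := ⟨hzt, mem_univ _⟩
    simpa only [indicator_of_mem hzS, uncurry] using hz
  rw [← ae_all_iff] at hcut
  filter_upwards [hcut] with z hz hzt
  obtain ⟨n, hn⟩ := exists_nat_one_div_lt hzt
  exact hz n hn

end Summit.NavierStokesRegularity.NavierStokesRegularity.Theorems.L3TimeExponentPincerSpaceTimeSwirlFree

end
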